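import Summits.BirchSwinnertonDyer.Rank1Residual.ManinAdditive.CMTwinStevensMinimal
import Summits.BirchSwinnertonDyer.Rank1Residual.ManinAdditive.CMTwinLattice
import Summits.BirchSwinnertonDyer.Rank1Residual.ManinAdditive.CMGammaOneRootLaw
import Literature.NumberTheory.EllipticCurves.UniformizationUniqueProofs
import Literature.NumberTheory.EllipticCurves.LatticeIndexThreeVeluProofs
import Literature.NumberTheory.EllipticCurves.RealLatticePeriodHalfPeriodsProofs
import HarnessLib

/-!
# E-es-133⁺ REDUCED TO CLASSIFICATION — E-es-133₂/133₃ `_holds`, Vélu lattice lemmas, SHAPE₂⁺/₃⁺, THEOREM 46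
(cell `bsd-f2-manin`, planner `es` g32, MEMO-es §46; T-es-51 part 1/2)

TYPER NOTE (typer g20, T-es-51 part 1/2).  SOURCE = HOME/es/g32/Sketch-es-g32.lean sha16 cc6f37ae87e431d3 (424 l.; es: farm rc 0 · 0 err · 0 warn ·
0 s∗rry, axioms standard) §1–§4 VERBATIM except this note and the split (the sketch exceeds the 400-line cap for theorem-bearing files: §5
COR 46 is the sibling `CMTwinStevensMinimalMembersCor.lean`).  CONTENT: **E-es-133₂/133₃ `CMOptimal.CMTwinLatticeLeTwo/Three` CLOSED IN THE KERNEL**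
(`cmTwinLatticeLeTwo_holds` / `cmTwinLatticeLeThree_holds` = g29's `…_of_uniformization_unique` edges ∘ the tree's `PeriodPair.uniformization_unique_holds`);
§2 order-member lattice lemmas (Vélu on the analytic side, kernel); §3 plain-def CLASSIFICATION SHAPES **`CMClassMembersTwo`** / **`CMClassMembersThree`**
(classical print binders: ℚ-isogeny classes of ℚ(i)/ℚ(√−3)-CM curves + Tate's algorithm; nothing asserted; [ChiloyanLozanoRobledo2021] bib key added by the
typer = arXiv:2001.05616 / Trans. LMS 8 (2021)); §4 **THEOREM 46** `cmTwinStevensMinimalTwo/Three_of_classMembers : CMClassMembers_p → CMTwinStevensMinimal_p`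
(E-es-133⁺_p ⟸ classification) — so the binder `hmin` of COR 45.R⁺/45.S is now a classical classification fact, not a cell law.  Refuter verdict
R-es-72 pending at landing time.  Imports = es's (three landed ManinAdditive leaves + three Literature `…Proofs`) — ROUTE-INDEPENDENT.  PARTITION 0 ·
beyond-print theorem: no · bears_on stmt-BirchSwinnertonDyer-22967 / 22968 (CM slices) · BSD is not proved by this; C2/C3 OPEN.

es's module docstring (verbatim) follows.

# Sketch-es-g32 — E-es-133⁺ REDUCED TO CLASSIFICATION: the Stevens-minimality of the twist-reduced CM twin in its
# WHOLE isogeny class is Vélu-at-the-lattice + uniformisation uniqueness (cell `bsd-f2-manin`, planner `es` g32, MEMO-es §46)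

LENS: Euler-system / explicit-reciprocity (Stevens 1989 §6 transplanted to `ℚ(i)`, `ℚ(√−3)`: the «étale isogeny»
half, Stevens' Thm (2.3) `ℒ(A∗) ⊆ ℒ(A)`, made a lattice computation).

§1  E-es-133₂/₃ (`CMTwinLatticeLeTwo/Three`) UNCONDITIONAL: g29's `…_of_uniformization_unique` edges composed with the
    tree's discharge `PeriodPair.uniformization_unique_holds` (Silverman AEC VI.5.1, `UniformizationUniqueProofs.lean`).
§2  ORDER-MEMBER LATTICE LEMMAS (pure lattice theory, kernel-checked): for period lattices with the invariants of
    `[0,0,0,−d²,0] → [0,0,0,−11d²,−14d³]` (`j = 1728 → 287496`, index 2), `[0,0,0,0,c³] → [0,0,0,−15c²,22c³]`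
    (`j = 0 → 54000`, index 2) and `c₆ = 216m³ → (c₄,c₆) = (1440m², 54648m³)` (`j = 0 → −12288000`, index 3, the
    `27a3 → 27a4` shape) the SOURCE lattice is contained in the TARGET lattice — by the tree's analytic Vélu theorems
    `PeriodPair.lattice_eq_of_velu_invariants` / `lattice_eq_of_velu_three_invariants` at the half- or third-period `z₀` with
    `℘(z₀) = d`, `−c`, `m` (existence: `exists_weierstrassP_eq` + `two_mul_mem_lattice_of_derivWeierstrassP_eq_zero` /
    `eval_ΨSq_weierstrassP_eq_zero_iff`).
§3  TYPED CLASSIFICATION FACTS (classical; nothing asserted): `CMClassMembersTwo` (= g30's `CMClassShapeTwo` + «the class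
    contains the globally minimal `j = 1728` curve with `c₄ = 48d²`», i.e. `[0,0,0,−d²,0]`) and `CMClassMembersThree` (the
    `j = 0` analogue over the three member shapes `j ∈ {0, 54000, −12288000}`).
§4  THEOREM 46 (kernel-checked): `CMClassMembersTwo → CMTwinStevensMinimalTwo` (E-es-133⁺₂) and
    `CMClassMembersThree → CMTwinStevensMinimalThree` (E-es-133⁺₃): case `j(W) = j(V)` is §1; an order member is reached
    from the root `V` either directly (§2) or through the twin (g29's λ-lemmas `lattice_le_of_gaussian/eisenstein_twist`,
    then §2), the twist-reduction hypothesis deciding which.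
CONSEQUENCE: in COR 45.R⁺/45.S (`CMGammaOneRootLaw.lean`) the binder `hmin : CMTwinStevensMinimalTwo/Three` is now a
CLASSICAL CLASSIFICATION FACT (isogeny classes of `ℚ(i)`/`ℚ(√−3)`-CM curves over `ℚ` + Tate's algorithm), no longer a cell law.
BC5: census CM-REROOT-v1 (sha16 54fa4276c4abf38c; 649 + 1848 classes, member shapes 174/174 at `p = 2`) and VELU-CHECK-v1
(b06c06372f557db2).  Nothing in §3 is asserted.  BSD is not proved by this; Manin's conjecture, C2 (`ManinOddAtFour`), C3
(`ManinPrimeToThreeAtNine`) are not proved by this.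
-/

set_option autoImplicit false

noncomputable section

namespace Summit.BirchSwinnertonDyer.Rank1Residual.ManinAdditive.KatoCurve.CMTwinMinimal

open Complex Polynomial WeierstrassCurve Literature.NumberTheory.EllipticCurves
  Literature.NumberTheory.EllipticCurves.ModularForms
  Summit.BirchSwinnertonDyer.Rank1Residual.ManinAdditive.KatoCurve.CMOptimal
  Summit.BirchSwinnertonDyer.Rank1Residual.ManinAdditive.KatoCurve.CMOptimal.TwinLattice

/-! ## §1 E-es-133₂ / E-es-133₃ unconditional -/

/-- **E-es-133₂ holds** (`CMTwinLatticeLeTwo`): g29's reduction to uniformisation uniqueness + the tree's discharge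
`PeriodPair.uniformization_unique_holds`. -/
theorem cmTwinLatticeLeTwo_holds : CMTwinLatticeLeTwo :=
  cmTwinLatticeLeTwo_of_uniformization_unique PeriodPair.uniformization_unique_holds

/-- **E-es-133₃ holds** (`CMTwinLatticeLeThree`). -/
theorem cmTwinLatticeLeThree_holds : CMTwinLatticeLeThree :=
  cmTwinLatticeLeThree_of_uniformization_unique PeriodPair.uniformization_unique_holds

/-! ## §2 Order-member lattice lemmas (Vélu on the analytic side) -/

section Velu

/-- A root `x` of `4X³ − g₂X − g₃` is the `℘`-value of a half-period. [folklore; Silverman AEC VI.3.6] -/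
theorem exists_halfPeriod_of_cubic_root (L : PeriodPair) {x : ℂ} (hx : 4 * x ^ 3 - L.g₂ * x - L.g₃ = 0) :
    ∃ z₀ ∉ L.lattice, 2 * z₀ ∈ L.lattice ∧ L.weierstrassP z₀ = x := by
  obtain ⟨z, hz, hzx⟩ := L.exists_weierstrassP_eq x
  refine ⟨z, hz, ?_, hzx⟩
  apply L.two_mul_mem_lattice_of_derivWeierstrassP_eq_zero hz
  have h := L.derivWeierstrassP_sq z hz
  rw [hzx] at h
  have h0 : L.derivWeierstrassP z ^ 2 = 0 := by rw [h]; linear_combination hx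
  exact pow_eq_zero_iff two_ne_zero |>.mp h0

/-- A root `x` of `4Ψ₃ = 12X⁴ − 6g₂X² − 12g₃X − g₂²/4` is the `℘`-value of a third-period. [folklore; Silverman AEC Ex. 3.7] -/
theorem exists_thirdPeriod_of_psi3_root (L : PeriodPair) {x : ℂ}
    (hx : 12 * x ^ 4 - 6 * L.g₂ * x ^ 2 - 12 * L.g₃ * x - L.g₂ ^ 2 / 4 = 0) :
    ∃ z₀ ∉ L.lattice, 3 * z₀ ∈ L.lattice ∧ L.weierstrassP z₀ = x := by
  obtain ⟨z, hz, hzx⟩ := L.exists_weierstrassP_eq x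
  refine ⟨z, hz, ?_, hzx⟩
  have key : (L.curve.ΨSq 3).eval (L.weierstrassP z) = 0 := by
    rw [WeierstrassCurve.ΨSq_three, eval_pow]
    refine pow_eq_zero_iff two_ne_zero |>.mpr ?_
    simp only [WeierstrassCurve.Ψ₃, WeierstrassCurve.b₂, WeierstrassCurve.b₄, WeierstrassCurve.b₆, WeierstrassCurve.b₈,
      PeriodPair.curve_a₁, PeriodPair.curve_a₂, PeriodPair.curve_a₃, PeriodPair.curve_a₄, PeriodPair.curve_a₆,
      eval_add, eval_mul, eval_pow, eval_C, eval_X, eval_ofNat]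
    rw [hzx]
    linear_combination (1 / 4 : ℂ) * hx
  have h3 := (L.eval_ΨSq_weierstrassP_eq_zero_iff hz 3).mp key
  exact_mod_cast h3

/-- **Order member at `j = 1728` (index 2).**  A lattice with `(g₂, g₃) = (4d², 0)` (the Néron lattice of `[0,0,0,−d²,0]`)
is contained in every lattice with `(g₂, g₃) = (44d², 56d³)` (the Néron lattice of the Vélu quotient `[0,0,0,−11d²,−14d³]`
by the `2`-torsion point `(d, 0)`; `j = 287496`, CM by `ℤ[2i]`). [cite: SilvermanAEC2009, III.4 Example 4.5] -/
theorem lattice_le_of_velu_two_gaussian (L L'' : PeriodPair) {d : ℂ} (hd : d ≠ 0)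
    (h2 : L.g₂ = 4 * d ^ 2) (h3 : L.g₃ = 0) (h2'' : L''.g₂ = 44 * d ^ 2) (h3'' : L''.g₃ = 56 * d ^ 3) :
    L.lattice ≤ L''.lattice := by
  obtain ⟨z₀, hz₀, h2z₀, hx₀⟩ := exists_halfPeriod_of_cubic_root L (x := d) (by rw [h2, h3]; ring)
  exact (L.lattice_eq_of_velu_invariants hz₀ h2z₀ (B := 2 * d ^ 2) (by rw [hx₀, h2]; ring)
    (mul_ne_zero two_ne_zero (pow_ne_zero 2 hd)) L'' (by rw [h2'', hx₀]; ring) (by rw [h3'', hx₀]; ring)).1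

/-- **Order member at `j = 0`, index 2.**  A lattice with `(g₂, g₃) = (0, −4c³)` (the Néron lattice of `[0,0,0,0,c³]`) is
contained in every lattice with `(g₂, g₃) = (60c², −88c³)` (the Vélu quotient `[0,0,0,−15c²,22c³]` by `(−c, 0)`; `j = 54000`,
CM by `ℤ[√−3]`). [cite: SilvermanAEC2009, III.4 Example 4.5] -/
theorem lattice_le_of_velu_two_eisenstein (L L'' : PeriodPair) {c : ℂ} (hc : c ≠ 0)
    (h2 : L.g₂ = 0) (h3 : L.g₃ = -4 * c ^ 3) (h2'' : L''.g₂ = 60 * c ^ 2) (h3'' : L''.g₃ = -88 * c ^ 3) :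
    L.lattice ≤ L''.lattice := by
  obtain ⟨z₀, hz₀, h2z₀, hx₀⟩ := exists_halfPeriod_of_cubic_root L (x := -c) (by rw [h2, h3]; ring)
  exact (L.lattice_eq_of_velu_invariants hz₀ h2z₀ (B := 3 * c ^ 2) (by rw [hx₀, h2]; ring)
    (mul_ne_zero three_ne_zero (pow_ne_zero 2 hc)) L'' (by rw [h2'', hx₀]; ring) (by rw [h3'', hx₀]; ring)).1

/-- **Order member at `j = 0`, index 3.**  A lattice with `(g₂, g₃) = (0, m³)` (the Néron lattice of a `j = 0` curve with
`c₆ = 216m³`, e.g. `27a3` with `m = −1`) is contained in every lattice with `(g₂, g₃) = (120m², 253m³)` (Vélu's quotient by the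
`3`-torsion subgroup `x = m`; `(c₄, c₆) = (1440m², 54648m³)`, `j = −12288000`, CM by `ℤ[3ω]`; the `27a3 → 27a4` shape).
[cite: SilvermanAEC2009, III.4.12–4.13] [cite: Velu1971] -/
theorem lattice_le_of_velu_three_eisenstein (L L'' : PeriodPair) {m : ℂ}
    (h2 : L.g₂ = 0) (h3 : L.g₃ = m ^ 3) (h2'' : L''.g₂ = 120 * m ^ 2) (h3'' : L''.g₃ = 253 * m ^ 3) :
    L.lattice ≤ L''.lattice := by
  obtain ⟨z₀, hz₀, h3z₀, hx₀⟩ := exists_thirdPeriod_of_psi3_root L (x := m) (by rw [h2, h3]; ring)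
  exact (L.lattice_eq_of_velu_three_invariants hz₀ h3z₀ L'' (by rw [h2'', hx₀, h2]; ring)
    (by rw [h3'', hx₀, h2, h3]; ring)).1

end Velu

/-! ## §3 Typed classification facts (classical; nothing asserted) -/

section Shapes

/-- **SHAPE₂⁺ `CMClassMembersTwo` (classical).**  Let `V`, `W` be globally minimal over `ℚ`, `j(V) = 1728`, `V ~ W`
isogenous.  Then either `j(W) = 1728`, or `W` is a `j = 287496` member: `(c₄, c₆)(W) = (528d², 12096d³)` with `d`
squarefree (g30's `CMClassShapeTwo`: the `32a3 ⊗ χ_d`, `d` odd, and `64a2 ⊗ χ_D`, `d = 2D`, families in ONE formula), AND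
the class contains the globally minimal `j = 1728` curve `[0,0,0,−d²,0]` (`c₄ = 48d²`) of which `W` is the Vélu quotient by
`(d, 0)`.  Classical: a curve isogenous over `ℚ` to a `ℚ(i)`-CM curve has CM by an order of `ℚ(i)` of class number one
(`ℤ[i]`, `ℤ[2i]`: `j ∈ {1728, 287496}`), the isogeny graph is `L₂(2)` or `T₄`, and Tate's algorithm gives the minimal
models.  Why it might fail: only through a slip in the minimal-model bookkeeping at `2` (census CM-REROOT-v1: member
shapes 174/174 curves, roots 649/649 classes of conductor `< 5·10⁵`).
[cite: ChiloyanLozanoRobledo2021, §3 + CM isogeny-torsion graph table] [cite: SilvermanAEC2009, III.4 Example 4.5; App. C §11] -/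
def CMClassMembersTwo : Prop :=
  ∀ (V W : WeierstrassCurve ℚ) [V.IsElliptic] [V.IsGloballyMinimal] [W.IsElliptic] [W.IsGloballyMinimal],
    V.j = 1728 → WeierstrassCurve.IsIsogenous V W →
    W.j = 1728 ∨
      ∃ d : ℤ, Squarefree d ∧ W.c₄ = 528 * (d : ℚ) ^ 2 ∧ W.c₆ = 12096 * (d : ℚ) ^ 3 ∧
        ∃ (W' : WeierstrassCurve ℚ) (_ : W'.IsElliptic) (_ : W'.IsGloballyMinimal),
          W'.j = 1728 ∧ WeierstrassCurve.IsIsogenous V W' ∧ W'.c₄ = 48 * (d : ℚ) ^ 2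

/-- **SHAPE₃⁺ `CMClassMembersThree` (classical).**  Let `V`, `W` be globally minimal over `ℚ`, `j(V) = 0`, `V ~ W`.
Then either `j(W) = 0`, or `W` is a `j = 54000` member — `(c₄, c₆)(W) = (720c², −19008c³)`, `c ≠ 0`, the Vélu quotient of the
globally minimal `j = 0` member with `c₆ = −864c³` (`[0,0,0,0,c³]`) by its `2`-torsion point `(−c, 0)`, that member lying in
the class — or a `j = −12288000` member — `(c₄, c₆)(W) = (1440m², 54648m³)`, `m ≠ 0`, the Vélu quotient of the globally
minimal `j = 0` member with `c₆ = 216m³` (the `27a3 → 27a4` shape and its twists) by its rational `3`-torsion subgroup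
`x = m`, that member lying in the class.  Classical: orders of `ℚ(√−3)` of class number one are `ℤ[ω]`, `ℤ[√−3]`, `ℤ[3ω]`
(`j ∈ {0, 54000, −12288000}`), isogeny graphs `L₂(3)`, `R₄(6)`, `L₄(27)`; Tate's algorithm for the models.  Why it might
fail: minimal-model bookkeeping at `2`, `3` (census CM-REROOT-v1: 1848/1848 classes, VELU-CHECK-v1).
[cite: ChiloyanLozanoRobledo2021, §3 + CM isogeny-torsion graph table] [cite: SilvermanAEC2009, III.4.12–4.13; App. C §11] -/
def CMClassMembersThree : Prop :=
  ∀ (V W : WeierstrassCurve ℚ) [V.IsElliptic] [V.IsGloballyMinimal] [W.IsElliptic] [W.IsGloballyMinimal],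
    V.j = 0 → WeierstrassCurve.IsIsogenous V W →
    W.j = 0 ∨
      (∃ c : ℚ, c ≠ 0 ∧ W.c₄ = 720 * c ^ 2 ∧ W.c₆ = -19008 * c ^ 3 ∧
        ∃ (W' : WeierstrassCurve ℚ) (_ : W'.IsElliptic) (_ : W'.IsGloballyMinimal),
          W'.j = 0 ∧ WeierstrassCurve.IsIsogenous V W' ∧ W'.c₆ = -864 * c ^ 3) ∨
      (∃ m : ℚ, m ≠ 0 ∧ W.c₄ = 1440 * m ^ 2 ∧ W.c₆ = 54648 * m ^ 3 ∧
        ∃ (W' : WeierstrassCurve ℚ) (_ : W'.IsElliptic) (_ : W'.IsGloballyMinimal),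
          W'.j = 0 ∧ WeierstrassCurve.IsIsogenous V W' ∧ W'.c₆ = 216 * m ^ 3)

end Shapes

/-! ## §4 THEOREM 46: E-es-133⁺ from the classification -/

section Theorem46

/-- The `(1+i)/2`-twin of a `g₃ = 0` lattice: a lattice `L₁ ⊇ L` with `g₂(L₁) = −4·g₂(L)`, `g₃(L₁) = 0`. -/
theorem exists_gaussian_twin_lattice (L : PeriodPair) (h3 : L.g₃ = 0) :
    ∃ L₁ : PeriodPair, L₁.g₂ = -4 * L.g₂ ∧ L₁.g₃ = 0 ∧ L.lattice ≤ L₁.lattice := by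
  -- `λ = (1+i)/2`, `λ⁴ = −1/4`
  have hl0 : ((1 + I) / 2 : ℂ) ≠ 0 := by
    intro h
    have := congrArg Complex.re h
    simp at this
  have hl4 : ((1 + I) / 2 : ℂ) ^ 4 = -1 / 4 := by
    linear_combination ((I ^ 2 + 4 * I + 5) / 16) * Complex.I_sq
  refine ⟨smulPair _ hl0 L, ?_, ?_, ?_⟩
  · rw [g₂_smulPair, hl4]; ring
  · rw [g₃_smulPair, h3, mul_zero]
  · refine lattice_le_of_gaussian_twist PeriodPair.uniformization_unique_holds L _ h3 ?_ ?_
    · rw [g₃_smulPair, h3, mul_zero]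
    · rw [g₂_smulPair, hl4]; ring

/-- The `1/√−3`-twin of a `g₂ = 0` lattice: a lattice `L₁ ⊇ L` with `g₂(L₁) = 0`, `g₃(L₁) = −27·g₃(L)`. -/
theorem exists_eisenstein_twin_lattice (L : PeriodPair) (h2 : L.g₂ = 0) :
    ∃ L₁ : PeriodPair, L₁.g₂ = 0 ∧ L₁.g₃ = -27 * L.g₃ ∧ L.lattice ≤ L₁.lattice := by
  have hs0 : ((((Real.sqrt 3 : ℝ) : ℂ) * I)⁻¹ : ℂ) ≠ 0 := inv_ne_zero sqrt_neg_three_ne_zero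
  have hs6 : ((((Real.sqrt 3 : ℝ) : ℂ) * I)⁻¹ : ℂ) ^ 6 = (-27)⁻¹ := by
    rw [inv_pow, sqrt_neg_three_pow_six]
  refine ⟨smulPair _ hs0 L, ?_, ?_, ?_⟩
  · rw [g₂_smulPair, h2, mul_zero]
  · rw [g₃_smulPair, hs6, inv_inv]
  · refine lattice_le_of_eisenstein_twist PeriodPair.uniformization_unique_holds L _ h2 ?_ ?_
    · rw [g₂_smulPair, h2, mul_zero]
    · rw [g₃_smulPair, hs6, inv_inv]

/-- **THEOREM 46₂.  E-es-133⁺₂ from the classification:** `CMClassMembersTwo → CMTwinStevensMinimalTwo`. -/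
theorem cmTwinStevensMinimalTwo_of_classMembers (hcl : CMClassMembersTwo) : CMTwinStevensMinimalTwo := by
  intro V W _ _ _ _ LV LW hjV hiso hLV hLW hred
  rcases hcl V W hjV hiso with hjW | ⟨d, hd, hW4, hW6, W', hE', hmin', hjW', hiso', hW'4⟩
  · exact cmTwinLatticeLeTwo_holds V W LV LW hjV hjW hiso hLV hLW hred
  · -- invariants of `LV`, `LW`
    have hV6 : V.c₆ = 0 := (Literature.AlgebraicGeometry.PlaneCurves.j_eq_1728_iff_c₆_eq_zero V).mp hjV
    obtain ⟨hV2, hV3⟩ := hLV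
    obtain ⟨hW2, hW3⟩ := hLW
    rw [baseChange_c₄] at hV2 hW2
    rw [baseChange_c₆] at hV3 hW3
    rw [hV6] at hV3
    rw [hW4] at hW2
    rw [hW6] at hW3
    push_cast at hV3 hW2 hW3
    rw [zero_div] at hV3
    have hd0 : ((d : ℚ) : ℂ) ≠ 0 := by exact_mod_cast hd.ne_zero
    have hLW2 : LW.g₂ = 44 * ((d : ℚ) : ℂ) ^ 2 := by rw [hW2]; push_cast; ring
    have hLW3 : LW.g₃ = 56 * ((d : ℚ) : ℂ) ^ 3 := by rw [hW3]; push_cast; ring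
    -- twist-reduction at the root member `W' = [0,0,0,−d²,0]`
    haveI := hE'
    haveI := hmin'
    rcases hred W' hjW' hiso' with h | h
    · -- `c₄(V) = 48d²`: `LV` is the root lattice, Vélu directly
      have hLV2 : LV.g₂ = 4 * ((d : ℚ) : ℂ) ^ 2 := by
        rw [hV2, ← h, hW'4]; push_cast; ring
      exact lattice_le_of_velu_two_gaussian LV LW hd0 hLV2 hV3 hLW2 hLW3
    · -- `c₄(V) = −12d²`: through the Gaussian twin
      have hV4 : (V.c₄ : ℂ) = -12 * ((d : ℚ) : ℂ) ^ 2 := by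
        have : (4 : ℚ) * V.c₄ = -48 * (d : ℚ) ^ 2 := by linear_combination h - hW'4
        have h' : V.c₄ = -12 * (d : ℚ) ^ 2 := by linear_combination (1 / 4 : ℚ) * this
        rw [h']; push_cast; ring
      have hLV2 : LV.g₂ = -(((d : ℚ) : ℂ) ^ 2) := by rw [hV2, hV4]; ring
      obtain ⟨L₁, h₁2, h₁3, hle⟩ := exists_gaussian_twin_lattice LV hV3
      have hL₁2 : L₁.g₂ = 4 * ((d : ℚ) : ℂ) ^ 2 := by rw [h₁2, hLV2]; ring
      exact hle.trans (lattice_le_of_velu_two_gaussian L₁ LW hd0 hL₁2 h₁3 hLW2 hLW3)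

/-- **THEOREM 46₃.  E-es-133⁺₃ from the classification:** `CMClassMembersThree → CMTwinStevensMinimalThree`. -/
theorem cmTwinStevensMinimalThree_of_classMembers (hcl : CMClassMembersThree) : CMTwinStevensMinimalThree := by
  intro V W _ _ _ _ LV LW hjV hiso hLV hLW hred
  have hV4 : V.c₄ = 0 := (WeierstrassCurve.j_eq_zero_iff (W := V)).mp hjV
  rcases hcl V W hjV hiso with hjW | ⟨c, hc, hW4, hW6, W', hE', hmin', hjW', hiso', hW'6⟩ |
      ⟨m, hm, hW4, hW6, W', hE', hmin', hjW', hiso', hW'6⟩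
  · exact cmTwinLatticeLeThree_holds V W LV LW hjV hjW hiso hLV hLW hred
  · -- `j(W) = 54000`
    obtain ⟨hV2, hV3⟩ := hLV
    obtain ⟨hW2, hW3⟩ := hLW
    rw [baseChange_c₄] at hV2 hW2
    rw [baseChange_c₆] at hV3 hW3
    rw [hV4] at hV2
    rw [hW4] at hW2
    rw [hW6] at hW3
    push_cast at hV2 hW2 hW3
    rw [zero_div] at hV2
    have hc0 : ((c : ℚ) : ℂ) ≠ 0 := by exact_mod_cast hc
    have hLW2 : LW.g₂ = 60 * (c : ℂ) ^ 2 := by rw [hW2]; ring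
    have hLW3 : LW.g₃ = -88 * (c : ℂ) ^ 3 := by rw [hW3]; ring
    haveI := hE'
    haveI := hmin'
    rcases hred W' hjW' hiso' with h | h
    · have hLV3 : LV.g₃ = -4 * (c : ℂ) ^ 3 := by
        rw [hV3, ← h, hW'6]; push_cast; ring
      exact lattice_le_of_velu_two_eisenstein LV LW hc0 hV2 hLV3 hLW2 hLW3
    · have hV6 : (V.c₆ : ℂ) = 32 * (c : ℂ) ^ 3 := by
        have : (27 : ℚ) * V.c₆ = 864 * c ^ 3 := by linear_combination h - hW'6
        have h' : V.c₆ = 32 * c ^ 3 := by linear_combination (1 / 27 : ℚ) * this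
        rw [h']; push_cast; ring
      have hLV3 : LV.g₃ = 4 * (c : ℂ) ^ 3 / 27 := by rw [hV3, hV6]; ring
      obtain ⟨L₁, h₁2, h₁3, hle⟩ := exists_eisenstein_twin_lattice LV hV2
      have hL₁3 : L₁.g₃ = -4 * (c : ℂ) ^ 3 := by rw [h₁3, hLV3]; ring
      exact hle.trans (lattice_le_of_velu_two_eisenstein L₁ LW hc0 h₁2 hL₁3 hLW2 hLW3)
  · -- `j(W) = −12288000`
    obtain ⟨hV2, hV3⟩ := hLV
    obtain ⟨hW2, hW3⟩ := hLW
    rw [baseChange_c₄] at hV2 hW2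
    rw [baseChange_c₆] at hV3 hW3
    rw [hV4] at hV2
    rw [hW4] at hW2
    rw [hW6] at hW3
    push_cast at hV2 hW2 hW3
    rw [zero_div] at hV2
    have hLW2 : LW.g₂ = 120 * (m : ℂ) ^ 2 := by rw [hW2]; ring
    have hLW3 : LW.g₃ = 253 * (m : ℂ) ^ 3 := by rw [hW3]; ring
    haveI := hE'
    haveI := hmin'
    rcases hred W' hjW' hiso' with h | h
    · have hLV3 : LV.g₃ = (m : ℂ) ^ 3 := by
        rw [hV3, ← h, hW'6]; push_cast; ring
      exact lattice_le_of_velu_three_eisenstein LV LW hV2 hLV3 hLW2 hLW3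
    · have hV6 : (V.c₆ : ℂ) = -8 * (m : ℂ) ^ 3 := by
        have : (27 : ℚ) * V.c₆ = -216 * m ^ 3 := by linear_combination h - hW'6
        have h' : V.c₆ = -8 * m ^ 3 := by linear_combination (1 / 27 : ℚ) * this
        rw [h']; push_cast; ring
      have hLV3 : LV.g₃ = -(m : ℂ) ^ 3 / 27 := by rw [hV3, hV6]; ring
      obtain ⟨L₁, h₁2, h₁3, hle⟩ := exists_eisenstein_twin_lattice LV hV2
      have hL₁3 : L₁.g₃ = (m : ℂ) ^ 3 := by rw [h₁3, hLV3]; ring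
      exact hle.trans (lattice_le_of_velu_three_eisenstein L₁ LW h₁2 hL₁3 hLW2 hLW3)

end Theorem46

end Summit.BirchSwinnertonDyer.Rank1Residual.ManinAdditive.KatoCurve.CMTwinMinimal

end
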